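import Literature.Probability.RandomPlanarGeometry.SAWKSitePatternRigid
import Literature.Probability.RandomPlanarGeometry.SAWCubeRouting
import HarnessLib

/-!
# The pattern of Figure 9.11 lies on a corner-to-corner walk in a square (towards Kesten's bound for it)

Topic `Literature/Probability/RandomPlanarGeometry` (over `SAWKSitePatternRigid.lean`: the pattern `Thm942.pat k = P_k`
of Madras–Slade Figure 9.11; `SAWCubeRouting.lean`: `PathOn L π`, a self-avoiding nearest-neighbour piece). Source:
N. Madras, G. Slade, *The Self-Avoiding Walk* (Birkhäuser 1993), §9.7.2 (p. 350: "Since `P` is a proper internal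
pattern, Kesten's Pattern Theorem 7.2.3 tells us …") with Proposition 7.1.3 (b) (p. 232: a pattern is proper internal
iff it occurs on a self-avoiding walk joining two corners of a cube and staying inside it).

THIS FILE (namespace `Literature.Probability.RandomPlanarGeometry.SAW.Zd.Thm942`): the explicit corner-to-corner walk
`phi k` in the square `{0,…,k+13}²` — `(0,0) → (4,0)` along the bottom row, then the translate `P_k + (4,1)`
(from `(4,1)` to `(5,1)`), then `(5,0) → (k+13,0)` along the bottom row and up the right column to `(k+13,k+13)` —
with `phi_pathOn` (self-avoiding nearest-neighbour, `12k+66` steps), `phi_mem_square`, `phi_zero`, `phi_last`, and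
`phi_occ : phi k (5+t) - phi k 5 = P_k(t)` (`P_k` occurs on it at step `5`). This is the input "`P` is a proper internal
pattern" of (9.7.5), in the form consumed by the §7 chain's `thm723b_of_cornerWalk`.

## References
* N. Madras, G. Slade, *The Self-Avoiding Walk*, Birkhäuser (1993): Proposition 7.1.3 (p. 232), Theorem 7.2.3
  (p. 233), §9.7.2 (p. 350).
-/

noncomputable section

open Finset Literature.Probability.LatticeModels Literature.Probability.Percolation SimpleGraph
open scoped BigOperators

namespace Literature.Probability.RandomPlanarGeometry.SAW.Zd

namespace Thm942

open LocalMove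

/-- Two sites of `ℤ²` are equal iff their coordinates are. [folklore] -/
private theorem site2_eq_iff' (p q : Site 2) : p = q ↔ p 0 = q 0 ∧ p 1 = q 1 := by
  constructor
  · rintro rfl; exact ⟨rfl, rfl⟩
  · rintro ⟨h0, h1⟩; ext j; fin_cases j <;> assumption

/-- Coordinates of `![a, b]`. [folklore] -/
@[simp] private theorem vec2_zero' (a b : ℤ) : (![a, b] : Site 2) 0 = a := rfl

/-- Coordinates of `![a, b]`. [folklore] -/
@[simp] private theorem vec2_one' (a b : ℤ) : (![a, b] : Site 2) 1 = b := rfl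

/-- Adjacency in `ℤ²` in coordinates. [folklore] -/
private theorem adj_iff' (p q : Site 2) : (zdGraph 2).Adj p q ↔
    (q 0 = p 0 + 1 ∧ q 1 = p 1) ∨ (q 0 = p 0 - 1 ∧ q 1 = p 1) ∨
      (q 0 = p 0 ∧ q 1 = p 1 + 1) ∨ (q 0 = p 0 ∧ q 1 = p 1 - 1) := by
  rw [zdGraph_adj_iff]
  constructor
  · rintro ⟨i, h | h⟩
    · have h0 := congrFun h 0
      have h1 := congrFun h 1
      fin_cases i
      · left; simp at h0 h1; exact ⟨h0, h1⟩
      · right; right; left; simp at h0 h1; exact ⟨h0, h1⟩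
    · have h0 := congrFun h 0
      have h1 := congrFun h 1
      fin_cases i
      · right; left; simp at h0 h1; constructor <;> omega
      · right; right; right; simp at h0 h1; constructor <;> omega
  · intro h
    rcases h with ⟨h0, h1⟩ | ⟨h0, h1⟩ | ⟨h0, h1⟩ | ⟨h0, h1⟩
    · refine ⟨0, Or.inl ?_⟩; ext j; fin_cases j <;> simp [h0, h1]
    · refine ⟨0, Or.inr ?_⟩; ext j; fin_cases j <;> simp <;> omega
    · refine ⟨1, Or.inl ?_⟩; ext j; fin_cases j <;> simp [h0, h1]
    · refine ⟨1, Or.inr ?_⟩; ext j; fin_cases j <;> simp <;> omega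

/-- Coordinates of `P_k`. [folklore] -/
@[simp] private theorem pat_apply_zero' (k t : ℕ) : pat k t 0 = patX k t := rfl

/-- Coordinates of `P_k`. [folklore] -/
@[simp] private theorem pat_apply_one' (k t : ℕ) : pat k t 1 = patY k t := rfl

/-! ### The corner walk `φ_k` -/

/-- `x`-coordinate of `φ_k(t)`: `(0,0) → (4,0)`, then `P_k + (4,1)`, then `(5,0) → (k+13,0) → (k+13,k+13)`.
[cite: MadrasSlade1993, Proposition 7.1.3 (b) (p. 232)] -/
def phiX (k t : ℕ) : ℤ :=
  if t ≤ 4 then t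
  else if t ≤ 10 * k + 44 then patX k (t - 5) + 4
  else if t ≤ 11 * k + 53 then (t : ℤ) - 10 * k - 40
  else (k : ℤ) + 13

/-- `y`-coordinate of `φ_k(t)`. [cite: MadrasSlade1993, Proposition 7.1.3 (b) (p. 232)] -/
def phiY (k t : ℕ) : ℤ :=
  if t ≤ 4 then 0
  else if t ≤ 10 * k + 44 then patY k (t - 5) + 1
  else if t ≤ 11 * k + 53 then 0
  else (t : ℤ) - 11 * k - 53

/-- **The corner-to-corner walk `φ_k`** in the square `{0,…,k+13}²` carrying `P_k` at step `5`.
[cite: MadrasSlade1993, Proposition 7.1.3 (b) (p. 232)] -/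
def phi (k : ℕ) (t : ℕ) : Site 2 := ![phiX k t, phiY k t]

/-- Coordinates of `φ_k`. [folklore] -/
@[simp] private theorem phi_apply_zero (k t : ℕ) : phi k t 0 = phiX k t := rfl

/-- Coordinates of `φ_k`. [folklore] -/
@[simp] private theorem phi_apply_one (k t : ℕ) : phi k t 1 = phiY k t := rfl

/-- Piece 1: the bottom-left run. [folklore] -/
private theorem phi_p1 {k t : ℕ} (h : t ≤ 4) : phi k t = ![(t : ℤ), 0] := by
  rw [site2_eq_iff']; simp [phiX, phiY, h]

/-- Piece 2: the translate of `P_k`. [folklore] -/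
private theorem phi_p2 {k t : ℕ} (h1 : 5 ≤ t) (h2 : t ≤ 10 * k + 44) :
    phi k t = ![patX k (t - 5) + 4, patY k (t - 5) + 1] := by
  have h' : ¬ t ≤ 4 := by omega
  rw [site2_eq_iff']; simp [phiX, phiY, h', h2]

/-- Piece 3: the bottom-right run. [folklore] -/
private theorem phi_p3 {k t : ℕ} (h1 : 10 * k + 45 ≤ t) (h2 : t ≤ 11 * k + 53) :
    phi k t = ![(t : ℤ) - 10 * k - 40, 0] := by
  have h' : ¬ t ≤ 4 := by omega
  have h'' : ¬ t ≤ 10 * k + 44 := by omega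
  rw [site2_eq_iff']; simp [phiX, phiY, h', h'', h2]

/-- Piece 4: the right column. [folklore] -/
private theorem phi_p4 {k t : ℕ} (h1 : 11 * k + 54 ≤ t) : phi k t = ![(k : ℤ) + 13, (t : ℤ) - 11 * k - 53] := by
  have h' : ¬ t ≤ 4 := by omega
  have h'' : ¬ t ≤ 10 * k + 44 := by omega
  have h3 : ¬ t ≤ 11 * k + 53 := by omega
  rw [site2_eq_iff']; simp [phiX, phiY, h', h'', h3]

/-- `φ_k` starts at the corner `(0,0)`. [cite: MadrasSlade1993, Proposition 7.1.3 (b)] -/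
theorem phi_zero (k : ℕ) : phi k 0 = ![0, 0] := by rw [phi_p1 (by omega)]; simp

/-- `φ_k` ends at the corner `(k+13, k+13)` after `12k+66` steps. [cite: MadrasSlade1993, Proposition 7.1.3 (b)] -/
theorem phi_last (k : ℕ) : phi k (12 * k + 66) = ![(k : ℤ) + 13, (k : ℤ) + 13] := by
  rw [phi_p4 (by omega)]; congr 1; push_cast; ring_nf

/-- `P_k` occurs on `φ_k` at step `5`: `φ_k(5+t) = P_k(t) + (4,1)`, so `φ_k(5+t) - φ_k(5) = P_k(t)` (`P_k(0) = 0`).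
[cite: MadrasSlade1993, Proposition 7.1.3 (b), §9.7.2 (p. 350)] -/
theorem phi_occ (k : ℕ) {t : ℕ} (ht : t ≤ 10 * k + 39) : phi k (5 + t) - phi k 5 = pat k t := by
  rw [phi_p2 (by omega) (by omega), phi_p2 (by omega) (by omega)]
  have h0 := pat_zero k
  rw [site2_eq_iff'] at h0
  simp only [pat_apply_zero', pat_apply_one'] at h0
  rw [site2_eq_iff']
  simp only [Pi.sub_apply, vec2_zero', vec2_one', show 5 + t - 5 = t by omega, show (5 : ℕ) - 5 = 0 by rfl]
  rw [show patX k t = pat k t 0 from rfl, show patY k t = pat k t 1 from rfl,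
    show patX k 0 = pat k 0 0 from rfl, show patY k 0 = pat k 0 1 from rfl, pat_zero]
  simp

/-- Every site of `φ_k` lies in the square `{0,…,k+13}²`. [cite: MadrasSlade1993, Proposition 7.1.3 (b)] -/
theorem phi_mem_square (k : ℕ) {t : ℕ} (ht : t ≤ 12 * k + 66) (j : Fin 2) :
    0 ≤ phi k t j ∧ phi k t j ≤ ((k + 13 : ℕ) : ℤ) := by
  have hb := pat_mem_box k (t - 5)
  fin_cases j <;> simp only [phi, Fin.zero_eta, Fin.isValue, Fin.mk_one, vec2_zero', vec2_one', phiX, phiY] <;>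
    push_cast <;> split_ifs <;> omega

/-- `φ_k` makes nearest-neighbour steps. [cite: MadrasSlade1993, Proposition 7.1.3 (b)] -/
theorem phi_adj (k : ℕ) {t : ℕ} (ht : t < 12 * k + 66) : (zdGraph 2).Adj (phi k t) (phi k (t + 1)) := by
  rcases Nat.lt_or_ge (t + 1) 5 with h | h
  · rw [adj_iff', phi_p1 (by omega), phi_p1 (by omega)]; simp
  rcases Nat.lt_or_ge t 5 with h' | h'
  · -- `(4,0) → (4,1) = P(0) + (4,1)`
    have ht4 : t = 4 := by omega
    subst ht4
    rw [adj_iff', phi_p1 le_rfl, phi_p2 le_rfl (by omega)]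
    have h0 := pat_zero k
    rw [site2_eq_iff'] at h0
    simp only [pat_apply_zero', pat_apply_one'] at h0
    simp only [vec2_zero', vec2_one', show (5 : ℕ) - 5 = 0 by rfl, h0.1, h0.2]
    norm_num
  rcases Nat.lt_or_ge (t + 1) (10 * k + 45) with h2 | h2
  · -- inside the translate of `P_k`
    have := pat_adj k (t := t - 5) (by omega)
    rw [adj_iff'] at this ⊢
    rw [phi_p2 h' (by omega), phi_p2 (by omega) (by omega)]
    simp only [vec2_zero', vec2_one', pat_apply_zero', pat_apply_one'] at this ⊢
    rw [show t + 1 - 5 = t - 5 + 1 by omega]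
    omega
  rcases Nat.lt_or_ge t (10 * k + 45) with h3 | h3
  · -- `P(L) + (4,1) = (5,1) → (5,0)`
    have ht' : t = 10 * k + 44 := by omega
    subst ht'
    rw [adj_iff', phi_p2 (by omega) le_rfl, phi_p3 (by omega) (by omega)]
    have hL := pat_len k
    rw [site2_eq_iff'] at hL
    simp only [pat_apply_zero', pat_apply_one', vec2_zero', vec2_one'] at hL
    right; right; right
    rw [show 10 * k + 44 - 5 = 10 * k + 39 by omega]
    refine ⟨?_, ?_⟩
    · simp only [vec2_zero', hL.1]; push_cast; ring
    · simp only [vec2_one', hL.2]; norm_num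
  rcases Nat.lt_or_ge (t + 1) (11 * k + 54) with h4 | h4
  · rw [adj_iff', phi_p3 h3 (by omega), phi_p3 (by omega) (by omega)]
    left
    exact ⟨by simp only [vec2_zero']; push_cast; ring, by simp only [vec2_one']⟩
  rcases Nat.lt_or_ge t (11 * k + 54) with h5 | h5
  · have ht' : t = 11 * k + 53 := by omega
    subst ht'
    rw [adj_iff', phi_p3 (by omega) le_rfl, phi_p4 (by omega)]
    right; right; left
    exact ⟨by simp only [vec2_zero']; push_cast; ring, by simp only [vec2_one']; push_cast; ring⟩
  · rw [adj_iff', phi_p4 h5, phi_p4 (by omega)]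
    right; right; left
    exact ⟨by simp only [vec2_zero'], by simp only [vec2_one']; push_cast; ring⟩

/-- `φ_k` visits no site twice. [cite: MadrasSlade1993, Proposition 7.1.3 (b)] -/
theorem phi_injOn (k : ℕ) : Set.InjOn (phi k) {t | t ≤ 12 * k + 66} := by
  intro a ha b hb hab
  simp only [Set.mem_setOf_eq] at ha hb
  -- classify `a` and `b` by piece; pieces are pairwise disjoint as point sets
  have key : ∀ a b : ℕ, a ≤ 12 * k + 66 → b ≤ 12 * k + 66 → a ≤ b → phi k a = phi k b → a = b := by
    intro a b ha hb hle e
    have hbox := pat_mem_box k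
    rcases Nat.lt_or_ge a 5 with ha1 | ha1
    · rw [phi_p1 (by omega)] at e
      rcases Nat.lt_or_ge b 5 with hb1 | hb1
      · rw [phi_p1 (by omega), site2_eq_iff'] at e; simp at e; omega
      rcases Nat.lt_or_ge b (10 * k + 45) with hb2 | hb2
      · rw [phi_p2 hb1 (by omega), site2_eq_iff'] at e; simp at e; have := hbox (b - 5); omega
      rcases Nat.lt_or_ge b (11 * k + 54) with hb3 | hb3
      · rw [phi_p3 hb2 (by omega), site2_eq_iff'] at e; simp at e; omega
      · rw [phi_p4 hb3, site2_eq_iff'] at e; simp at e; omega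
    rcases Nat.lt_or_ge a (10 * k + 45) with ha2 | ha2
    · rw [phi_p2 ha1 (by omega)] at e
      rcases Nat.lt_or_ge b (10 * k + 45) with hb2 | hb2
      · rw [phi_p2 (by omega) (by omega), site2_eq_iff'] at e
        simp at e
        have := pat_injOn k (show a - 5 ∈ {t | t ≤ 10 * k + 39} by simp; omega)
          (show b - 5 ∈ {t | t ≤ 10 * k + 39} by simp; omega)
          ((site2_eq_iff' _ _).2 (by simp only [pat_apply_zero', pat_apply_one']; omega))
        omega
      rcases Nat.lt_or_ge b (11 * k + 54) with hb3 | hb3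
      · rw [phi_p3 hb2 (by omega), site2_eq_iff'] at e; simp at e; have := hbox (a - 5); omega
      · rw [phi_p4 hb3, site2_eq_iff'] at e; simp at e; have := hbox (a - 5); omega
    rcases Nat.lt_or_ge a (11 * k + 54) with ha3 | ha3
    · rw [phi_p3 ha2 (by omega)] at e
      rcases Nat.lt_or_ge b (11 * k + 54) with hb3 | hb3
      · rw [phi_p3 (by omega) (by omega), site2_eq_iff'] at e; simp at e; omega
      · rw [phi_p4 hb3, site2_eq_iff'] at e; simp at e; omega
    · rw [phi_p4 ha3, phi_p4 (by omega), site2_eq_iff'] at e; simp at e; omega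
  rcases le_total a b with h | h
  · exact key a b ha hb h hab
  · exact (key b a hb ha h hab.symm).symm

/-- **`φ_k` is a self-avoiding nearest-neighbour walk of `12k+66` steps.** [cite: MadrasSlade1993, Proposition 7.1.3
(b)] -/
theorem phi_pathOn (k : ℕ) : PathOn (12 * k + 66) (phi k) := ⟨fun _ ht => phi_adj k ht, phi_injOn k⟩

end Thm942

end Literature.Probability.RandomPlanarGeometry.SAW.Zd
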